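import Summits.CriticalPhenomena.PercolationContinuityZ3.Theorems.Transplant.SkelNegBParamsRootVals
import Summits.CriticalPhenomena.PercolationContinuityZ3.Theorems.Transplant.SkelNegBParamsFoot
import HarnessLib

/-!
# N1 params, chain of record `NegB`, part FaceTop: THE (F) NUMBERS LAYER'S LATTICE / TOP-LAYER / FOOT BINDERS AT THE LEDGER — hp-8 g33's
# `numsX_of_floors` / `numsY_of_floors` / `hkits_faceSteps_of_nums5` hypotheses `hA hκ₀ hc0 hc1 hmod0 hD hDd hv hlay hmodlo hmodhi hnear₂`
# served verbatim at `prF` (stmt-g15 2026-08-21; (F) binder map, lane INBOX)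
At the lattice record of record `prF = ⟨800, n_L, h_L, v_L, v_β, 20K·s₀, 20K·s₁, D⟩` (part Sched): `c₀ = A·u₀`, `c₁ = A·u₁` with the stride units
`u_i = Kq·s_i` (part RootVals), `D = A²·m` with `m = modulus n_L h_L v_L v_β` (part RootLam), the top-layer sandwich `n_Lℓ_L − U_L + 1 ≤ m ≤ n_Lℓ_L`
(`U_L = shearUnit n_L h_L = n_L + |h_L|`; from `v_β := ⌊(n_Lℓ_L + h_Lv_L)/n_L⌋`), the layer inequality `n_L + |h_L| ≤ n_Lℓ_L + 1` at `g := gT` (part SlotsT's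
`layer_T`), and the foot reading `hnear₂` for ANY base vertex `c` at `kA := (kFoot₀, kFoot₁)` (part Foot).
builds on p205010 (kernel theorem, internal audit signed; external expert review pending) — nothing in this file uses p205010; NOTHING is claimed about
the node `SamePDropOfSkeletonNeg₁` (OPEN; its (F) column is reduced to the B.18 floors, lead g7 V118).
Lane `prim-bschramm-*`, seat `prim-bschramm-stmt` (gen 15); helper file (`--supports stmt-CriticalPhenomena-4575 --as helper`); ledger HOME/prim-bschramm-stmt/NEG-PARAMS.md.
* §1 `c₀_eq_A_mul_u₀`, `c₁_eq_A_mul_u₁`, `u_nonneg`, `D_eq_A_sq_mul`, `modulus_top`, **`lattice_R`** (the bundle); §2 **`hlay_T`**; §3 **`hnear₂_R`**.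
[cite: KozmaNitzan2024, §4 Lemma 10 (pp. 17–21), Lemma 12 (pp. 23–25)] [cite: MartineauTassion2017, §4.1, §4.3 Lemma 4.2]
-/

noncomputable section

open scoped Classical

namespace Summit.CriticalPhenomena.PercolationContinuityZ3.Theorems.Transplant

namespace PlanarSkeletonNeg

namespace NegB

open Literature.Probability.Percolation Literature.Probability.LatticeModels SimpleGraph
open SkelConc (Consts)
open Skelφ (shearUnit)
open Skelφ.StepI (DataN)
open TwoAxis.Para (modulus)
open Neg

/-! ## §1 The lattice record's unit / determinant / top-layer facts -/

section Lattice

variable (κ : Consts) {V : Type} [DecidableEq V] [Countable V] {G : SimpleGraph V} [G.LocallyFinite] (Φ : PlanarSkeletonNeg G) (t : V)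
  (p : unitInterval) (D : DataN V) (g f : ℕ)

/-- **`c₀ = A·u₀`** (hp-8's `hc0` with `κ₀ := u₀ = Kq·s₀`). [folklore] -/
theorem c₀_eq_A_mul_u₀ : (prF κ Φ t p D g f).c₀ = (prF κ Φ t p D g f).A * KS.u₀ κ Φ t p D g f := by
  rw [(prF_fields κ Φ t p D g f).2.2.2.2.2.1, (prF_fields κ Φ t p D g f).1]; exact (KS.units_eq κ Φ t p D g f).1

/-- **`c₁ = A·u₁`** (hp-8's `hc1` with `κ₁ := u₁ = Kq·s₁`). [folklore] -/
theorem c₁_eq_A_mul_u₁ : (prF κ Φ t p D g f).c₁ = (prF κ Φ t p D g f).A * KS.u₁ κ Φ t p D g f := by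
  rw [(prF_fields κ Φ t p D g f).2.2.2.2.2.2.1, (prF_fields κ Φ t p D g f).1]; exact (KS.units_eq κ Φ t p D g f).2.1

/-- `0 ≤ u₀`, `0 ≤ u₁` (indeed `1 ≤ u_i`). [folklore] -/
theorem u_nonneg : 0 ≤ KS.u₀ κ Φ t p D g f ∧ 0 ≤ KS.u₁ κ Φ t p D g f := by
  obtain ⟨-, -, -, -, -, -, h0, h1⟩ := KS.units_eq κ Φ t p D g f
  exact ⟨by linarith, by linarith⟩

/-- **`D = A²·m`** at the record's own fields (hp-8's `hD` with `mod := modulus n_L h_L v_L v_β`). [folklore] -/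
theorem D_eq_A_sq_mul : (prF κ Φ t p D g f).D =
    (prF κ Φ t p D g f).A ^ 2 * modulus ((prF κ Φ t p D g f).n : ℤ) (prF κ Φ t p D g f).h (prF κ Φ t p D g f).vα (prF κ Φ t p D g f).vβ := by
  obtain ⟨hA, hn, hh, hv, hvb, -, -, hD⟩ := prF_fields κ Φ t p D g f
  rw [hD, hA, hn, hh, hv, hvb]; exact Dof_eq_sq_mul κ Φ t p D g f

/-- **The top-layer sandwich** `n_Lℓ_L − U_L + 1 ≤ m ≤ n_Lℓ_L` (`1 ≤ n_L`; hp-8's `hmodlo`/`hmodhi`). [folklore] -/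
theorem modulus_top (hn : 1 ≤ nL κ Φ t p D g f) :
    (nL κ Φ t p D g f : ℤ) * ℓL κ Φ t p D g f - (shearUnit (nL κ Φ t p D g f) (hL κ Φ t p D g f) : ℤ) + 1 ≤
        modulus (nL κ Φ t p D g f) (hL κ Φ t p D g f) (vL κ Φ t p D g f) (vβL κ Φ t p D g f) ∧
      modulus (nL κ Φ t p D g f) (hL κ Φ t p D g f) (vL κ Φ t p D g f) (vβL κ Φ t p D g f) ≤ (nL κ Φ t p D g f : ℤ) * ℓL κ Φ t p D g f := by
  obtain ⟨h1, h2⟩ := Skelφ.NegPrm.modulus_vβOf hn (hL κ Φ t p D g f) (ℓL κ Φ t p D g f) (vL κ Φ t p D g f)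
  have hU : (nL κ Φ t p D g f : ℤ) ≤ (shearUnit (nL κ Φ t p D g f) (hL κ Φ t p D g f) : ℤ) := by
    simp only [Skelφ.shearUnit, Nat.cast_add, Int.natCast_natAbs]; linarith [abs_nonneg (hL κ Φ t p D g f)]
  exact ⟨by change _ ≤ modulus _ _ _ (Skelφ.NegPrm.vβOf _ _ _ _); linarith, h2⟩

/-- **THE LATTICE BUNDLE AT THE LEDGER** (under the numeric long clause): `0 < A`, `c₀ = A·u₀`, `c₁ = A·u₁`, `0 ≤ u₀`, `0 ≤ u₁`, `0 < m`, `D = A²·m`,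
`D = detD A n h v_α v_β`, `|v_L| ≤ n_L`, `1 ≤ n_L`, `1 ≤ ℓ_L`, and the top-layer sandwich — hp-8's `hA0/hA, hc0, hc1, hκ₀, hmf/hmod0, hD, hDd, hvL/hv, hnL, hmodlo, hmodhi`.
[folklore] -/
theorem lattice_R (hN : EqNumL κ Φ t p D g f) :
    0 < (prF κ Φ t p D g f).A ∧ (prF κ Φ t p D g f).c₀ = (prF κ Φ t p D g f).A * KS.u₀ κ Φ t p D g f ∧
      (prF κ Φ t p D g f).c₁ = (prF κ Φ t p D g f).A * KS.u₁ κ Φ t p D g f ∧ 0 ≤ KS.u₀ κ Φ t p D g f ∧ 0 ≤ KS.u₁ κ Φ t p D g f ∧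
      0 < modulus (nL κ Φ t p D g f) (hL κ Φ t p D g f) (vL κ Φ t p D g f) (vβL κ Φ t p D g f) ∧
      (prF κ Φ t p D g f).D = (prF κ Φ t p D g f).A ^ 2 * modulus (nL κ Φ t p D g f) (hL κ Φ t p D g f) (vL κ Φ t p D g f) (vβL κ Φ t p D g f) ∧
      (prF κ Φ t p D g f).D = TwoAxis.Para.detD (prF κ Φ t p D g f).A (prF κ Φ t p D g f).n (prF κ Φ t p D g f).h (prF κ Φ t p D g f).vα (prF κ Φ t p D g f).vβ ∧
      |vL κ Φ t p D g f| ≤ (nL κ Φ t p D g f : ℤ) ∧ 1 ≤ nL κ Φ t p D g f ∧ 1 ≤ ℓL κ Φ t p D g f ∧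
      (nL κ Φ t p D g f : ℤ) * ℓL κ Φ t p D g f - (shearUnit (nL κ Φ t p D g f) (hL κ Φ t p D g f) : ℤ) + 1 ≤
        modulus (nL κ Φ t p D g f) (hL κ Φ t p D g f) (vL κ Φ t p D g f) (vβL κ Φ t p D g f) ∧
      modulus (nL κ Φ t p D g f) (hL κ Φ t p D g f) (vL κ Φ t p D g f) (vβL κ Φ t p D g f) ≤ (nL κ Φ t p D g f : ℤ) * ℓL κ Φ t p D g f := by
  obtain ⟨hn1, hℓ1⟩ := one_le_of_eqNumL κ Φ t p D g f hN
  obtain ⟨hA, -, hm, -, -, -⟩ := prF_pos κ Φ t p D g f hN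
  obtain ⟨hlo, hhi⟩ := modulus_top κ Φ t p D g f hn1
  exact ⟨hA, c₀_eq_A_mul_u₀ κ Φ t p D g f, c₁_eq_A_mul_u₁ κ Φ t p D g f, (u_nonneg κ Φ t p D g f).1, (u_nonneg κ Φ t p D g f).2, hm,
    D_eq_A_sq_mul κ Φ t p D g f, prF_D κ Φ t p D g f, hN.v_le, hn1, hℓ1, hlo, hhi⟩

end Lattice

/-! ## §2 The layer inequality at `g := gT` -/

namespace KS

section Layer

variable (κ : Consts) {V : Type} [DecidableEq V] [Countable V] {G : SimpleGraph V} [G.LocallyFinite] (Φ : PlanarSkeletonNeg G) (t : V)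
  (p : unitInterval) (D : DataN V) (mk : ℕ) (gx : Neg.FSlot) (f : ℕ)

/-- **`hlay`** (hp-8's shape `(n_L + |h_L| : ℕ) ≤ n_L·ℓ_L + 1`) at `g := gT mk gx`, any `f` — one factor of `layer_T`'s `(RA′+3)·U_L ≤ n_Lℓ_L + 1`. [folklore] -/
theorem hlay_T (hN : EqNumL κ Φ t p D (gT mk gx κ Φ t p D) f) (hκ : (hL κ Φ t p D (gT mk gx κ Φ t p D) f).natAbs ≤ 10 * nL κ Φ t p D (gT mk gx κ Φ t p D) f) :
    ((nL κ Φ t p D (gT mk gx κ Φ t p D) f + (hL κ Φ t p D (gT mk gx κ Φ t p D) f).natAbs : ℕ) : ℤ) ≤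
      (nL κ Φ t p D (gT mk gx κ Φ t p D) f : ℤ) * ℓL κ Φ t p D (gT mk gx κ Φ t p D) f + 1 := by
  have h := layer_T κ Φ t p D mk gx f hN hκ
  have hU : (0 : ℤ) ≤ ((nL κ Φ t p D (gT mk gx κ Φ t p D) f + (hL κ Φ t p D (gT mk gx κ Φ t p D) f).natAbs : ℕ) : ℤ) := by positivity
  have hR : (1 : ℤ) ≤ (RA' κ Φ t p D mk : ℤ) + 3 := by omega
  nlinarith

end Layer

end KS

/-! ## §3 The foot reading for any base vertex -/

section Foot

variable (κ : Consts) {V : Type} [DecidableEq V] [Countable V] {G : SimpleGraph V} [G.LocallyFinite] (Φ : PlanarSkeletonNeg G) (t : V)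
  (p : unitInterval) (D : DataN V) (g f : ℕ)

/-- **`hnear₂`** (hp-8's binder shape, ANY base vertex `c`, ANY map `φ′`) at `kA := (kFoot₀ sα sβ, kFoot₁ sα sβ)`: a vertex within planar extents `(sα, sβ)`
of `c` has fine position within `(kFoot₀, kFoot₁)` in the fine skeleton about `c`. [folklore] -/
theorem hnear₂_R (hN : EqNumL κ Φ t p D g f) (sα sβ : ℤ) (φ' : V → Site 2) (c w : V) (h0 : |φ' w 0 - φ' c 0| ≤ sα) (h1 : |φ' w 1 - φ' c 1| ≤ sβ) :
    |Skelφ.fineSkel φ' c (prF κ Φ t p D g f).A ((prF κ Φ t p D g f).n : ℤ) (prF κ Φ t p D g f).h (prF κ Φ t p D g f).vα (prF κ Φ t p D g f).vβ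
        (prF κ Φ t p D g f).c₀ (prF κ Φ t p D g f).c₁ ((prF κ Φ t p D g f).D / 2) ((prF κ Φ t p D g f).D / 2) (prF κ Φ t p D g f).D w 0| ≤
        kFoot₀ κ Φ t p D g f sα sβ ∧
      |Skelφ.fineSkel φ' c (prF κ Φ t p D g f).A ((prF κ Φ t p D g f).n : ℤ) (prF κ Φ t p D g f).h (prF κ Φ t p D g f).vα (prF κ Φ t p D g f).vβ
        (prF κ Φ t p D g f).c₀ (prF κ Φ t p D g f).c₁ ((prF κ Φ t p D g f).D / 2) ((prF κ Φ t p D g f).D / 2) (prF κ Φ t p D g f).D w 1| ≤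
        kFoot₁ κ Φ t p D g f sα sβ := by
  obtain ⟨-, -, -, hc₀, hc₁, hD⟩ := prF_pos κ Φ t p D g f hN
  exact Skelφ.abs_fineSkel_le_of_near₂ (φ := φ') c hD hc₀.le hc₁.le (hL0_R κ Φ t p D g f sα sβ hN) (hL1_R κ Φ t p D g f sα sβ hN) h0 h1

end Foot

end NegB

end PlanarSkeletonNeg

end Summit.CriticalPhenomena.PercolationContinuityZ3.Theorems.Transplant

end
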